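import Literature.Computability.FineGrained.SerfRedProgram
import Literature.Computability.FineGrained.OVFromSETH
import HarnessLib

/-!
# SETH ⇒ OV (fine-grained.S09): sparsification as a word-RAM SERF reduction, proved (`kSATInRAMTime_of_sparseKSATInRAMTime_serf_holds`)

Companion to `Literature.Computability.FineGrained.OVFromSETH` (sibling of `OVFromSETHProofs.lean`, which
discharges the split-and-list fact): the discharge
`kSATInRAMTime_of_sparseKSATInRAMTime_serf_holds` of the named fact
`kSATInRAMTime_of_sparseKSATInRAMTime_serf` — the sparsification lemma of Impagliazzo–Paturi–Zane
(JCSS 63 (2001), Thm. 1, Cor. 1 and Cor. 2) as a SERF reduction on the word RAM at SETH granularity: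
for all `k` and `ε > 0` there is a density `C` such that for every `δ ≥ 0` an `O(2^{δ n})`
word-RAM algorithm for the `k`-CNFs with at most `C · n` clauses (`SparseKSATInRAMTime k C δ`) gives
an `O(2^{(δ+ε) n})` one for all of `k`-SAT (`KSATInRAMTime k (δ + ε)`).

The proof is the machine-level one announced in the fact's docstring, assembled from

* `sparsification_nodup` — Wave0's `sparsification` (proved as `sparsification_holds` from the
  algorithm `Reduce`, `SparsificationAlgorithm.lean`) with the extra information that the leaves have
  no repeated clause (`Sparsifier.nodup_thetaL`), at `ε/2`;
* the driver `SerfRed.driver` and its certificate `SerfRed.driver_outputsWithin`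
  (`SerfRedParser.lean`, `SerfRedPresent.lean`, `SerfRedProgram.lean`): relocate and transcode the
  input, simulate the multi-stack sparsifier on the word RAM with constant overhead
  (`TM2Emu.simProgram`), and for each of the `≤ 2^{ε n/2}` leaves parse its string, present it —
  padded with `x_{n-1} ∨ ¬x_{n-1}` when its last variable is absent, replaced by the empty formula when
  it has an empty clause — to the given sparse-`k`-SAT program run in the emulator of
  `…Cryptography.WordRAMEmulator` at its own word size, and or the answers
  (`SProg.withSubrunLoop`, `…Cryptography.WordRAMSubrunLoop`);
* the word size `K (n + width)` (`SerfRed.word_bounds₁` for the build phase and the stream, `ws_le`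
  for the emulated word sizes, `SerfRed.driver_instance`) and the time
  `poly(n) 2^{ε n/2} + 19 · |output| + 2^{ε n/2} · 38 · ⌊C₀ 2^{δ n} + C₀⌋ = O(2^{(δ+ε) n})`
  (`steps_le_floor`; the per-leaf parsing costs are summed, `∑ |ψᵢ.encode| = |output| ≤` the
  sparsifier's time, which is why the loop rule with per-iteration budgets is used).

## References

* R. Impagliazzo, R. Paturi, F. Zane, *Which problems have strongly exponential complexity?*,
  J. Comput. Syst. Sci. 63 (2001) 512–530, Theorem 1, Corollary 1, Corollary 2.
* V. Vassilevska Williams, *On some fine-grained questions in algorithms and complexity*,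
  Proc. ICM 2018, §2 (the word RAM; algorithms calling an algorithm for another problem).
-/

namespace Literature.Computability.FineGrained

open _root_.Computability Turing Real Cryptography Cryptography.WordRAM Cryptography.WordRAM.SProg Complexity
  KSatTranscoder SerfRed

attribute [local instance] Turing.FinTM2.kFin Turing.FinTM2.ΛFin Turing.FinTM2.σFin
  Turing.FinTM2.Γk₀Fin

open SparseSatBridge (padClause)

/-! ### Sparsification with pairwise distinct clauses -/

open Sparsifier in
/-- **The sparsification lemma, with leaves without repeated clauses.** The statement of Wave0's
`sparsification` (Impagliazzo–Paturi–Zane, JCSS 63 (2001), Thm. 1 / Cor. 1, proved as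
`sparsification_holds` from the algorithm `Reduce` of `SparsificationAlgorithm.lean`), together with
the observation that the leaves of that algorithm — the enumerations `thetaL G` of the minimal
literal sets of the node families — list each clause once (`Sparsifier.nodup_thetaL`), so that they
are instances of the word-RAM problem `kSATProblem k` (no repeated clause).
[cite: ImpagliazzoPaturiZaneJCSS2001, Theorem 1 and Corollary 1] -/
theorem sparsification_nodup (k : ℕ) (ε : ℝ) (hε : 0 < ε) :
    ∃ (C : ℕ) (F : KCNF k → List (KCNF k)) (T : ℕ → ℕ → ℕ),
      (∀ φ : KCNF k,
        ((F φ).length : ℝ) ≤ (2 : ℝ) ^ (ε * φ.numVars) ∧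
        (∀ ψ ∈ F φ, ψ.numVars = φ.numVars ∧ ψ.clauses.length ≤ C * φ.numVars ∧ ψ.clauses.Nodup) ∧
        ∀ v : ℕ → Bool, φ.eval v = true ↔ ∃ ψ ∈ F φ, ψ.eval v = true) ∧
      IsExpPolyBound ε T ∧
      ComputesInTime KCNF.encode KCNF.encodeList F fun φ => T φ.numVars φ.encode.length := by
  have hε' : 0 < ε / 108 := by positivity
  obtain ⟨M₀, hM₀2, y, hy, hnum⟩ := Sparsification.exists_good_params k hε'
  have hM₀ : 1 ≤ M₀ := by omega
  obtain ⟨Mach, hMach⟩ := ACom.exists_computesInTime (main (Sparsification.theta M₀) k) K.inp K.out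
    KCNF.encode KCNF.encodeList (outF M₀ k hM₀) (costOf M₀ k) (runs_main_outF hM₀ hy hnum)
  refine ⟨2 * thSum M₀ k, outF M₀ k hM₀, Tb M₀ k ε, fun φ => ⟨length_outF_le hM₀ hy hε hnum φ,
    fun ψ hψ => ⟨(mem_outF hM₀ hy hnum φ hψ).1, (mem_outF hM₀ hy hnum φ hψ).2, ?_⟩, eval_iff_exists_outF hM₀ hy hnum φ⟩,
    isExpPolyBound_Tb M₀ k ε, Mach, fun φ => (hMach φ).mono (costOf_succ_le_Tb hM₀ hy hnum φ)⟩
  -- the leaves are `thetaL` of node families, hence without repetitions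
  unfold outF at hψ
  by_cases hne : [] ∈ φ.clauses
  · rw [if_pos hne] at hψ; exact absurd hψ List.not_mem_nil
  · rw [if_neg hne] at hψ
    obtain ⟨Ml, hMl, rfl⟩ := List.mem_pmap.1 hψ
    obtain ⟨G, -, hG⟩ := exists_of_mem_treeL (Sparsification.one_le_theta hM₀) _ (wf_rootF φ) Ml hMl
    show Ml.Nodup
    rw [hG]; exact nodup_thetaL G

/-! ### Size facts of the leaves -/

/-- Variables below `m` give `numVars ≤ m`. [folklore] -/
theorem numVars_le_of_lt {cs : CNF ℕ} {m : ℕ} (h : ∀ c ∈ cs, ∀ l ∈ c, l.1 < m) : CNF.numVars cs ≤ m := by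
  rw [SerfRed.numVars_eq_lmax]
  refine lmax_le fun a ha => ?_
  obtain ⟨l, hl, rfl⟩ := List.mem_map.1 ha
  obtain ⟨c, hc, hlc⟩ := List.mem_flatten.1 hl
  exact h c hc l hlc

/-- The clause words of a `k`-CNF: one per clause and per literal. [folklore] -/
theorem length_clauseWords_le {k : ℕ} {cs : CNF ℕ} (hw : cs.IsWidthLE k) :
    (KSatTranscoder.clauseWords cs).length ≤ cs.length * (k + 1) := by
  rw [length_clauseWords]
  have := size_le_of_isWidthLE hw
  unfold CNF.numClauses at *
  nlinarith

/-- The clause words of a clause list on variables `< n` are below `2 n + k + 1`. [folklore] -/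
theorem clauseWords_lt {k n : ℕ} {cs : CNF ℕ} (hw : cs.IsWidthLE k) (hn : CNF.numVars cs ≤ n) :
    ∀ a ∈ KSatTranscoder.clauseWords cs, a < 2 * n + k + 1 := by
  intro a ha
  simp only [KSatTranscoder.clauseWords, List.mem_flatMap, List.mem_cons, List.mem_map] at ha
  obtain ⟨c, hc, ha⟩ := ha
  rcases ha with rfl | ⟨l, hl, rfl⟩
  · have := hw c hc; omega
  · have h1 : l.1 + 1 ≤ CNF.numVars cs := by
      rw [SerfRed.numVars_eq_lmax]
      exact le_lmax_of_mem (List.mem_map.2 ⟨l, List.mem_flatten.2 ⟨c, hc, hl⟩, rfl⟩)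
    unfold litWord; cases l.2 <;> simp <;> omega

/-- **The emulated word size of a leaf is `O(n)`**: `k' (numVars + inputWidth y) + 2 ≤ K₂ (n + 1)` with
`K₂ = k' (Cs (k + 1) + k + 14) + 2`, for a leaf with at most `Cs · n` clauses of width `≤ k` on
variables `< n`. [folklore] -/
theorem ws_le {k k' Cs n : ℕ} {cs : CNF ℕ} (hw : cs.IsWidthLE k) (hn : CNF.numVars cs ≤ n) (hlen : cs.length ≤ Cs * n) :
    k' * (CNF.numVars (pres k n cs) + inputWidth (encodeCNFWords (pres k n cs))) + 2 ≤ (k' * (Cs * (k + 1) + k + 14) + 2) * (n + 1) := by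
  set V := Cs * n * (k + 1) + 2 * n + k + 10 with hV
  have hY := length_clauseWords_le hw
  have hY' : (KSatTranscoder.clauseWords cs).length ≤ Cs * n * (k + 1) := hY.trans (Nat.mul_le_mul_right _ hlen)
  obtain ⟨hyV, hylen⟩ := pres_words_lt (k := k) (n := n) (V := V) (cs := cs) (by omega) (by omega) (by omega) hn
    (fun a ha => by have := clauseWords_lt hw hn a ha; omega)
  have hiw : inputWidth (encodeCNFWords (pres k n cs)) ≤ V :=
    (inputWidth_le_size (V := V) (by omega) (by omega) fun a ha => (hyV a ha).le).trans (Nat.size_le.2 Nat.lt_two_pow_self)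
  have hnv := numVars_pres_le (k := k) hn
  calc k' * (CNF.numVars (pres k n cs) + inputWidth (encodeCNFWords (pres k n cs))) + 2
      ≤ k' * (n + V) + 2 := by gcongr
    _ ≤ k' * ((Cs * (k + 1) + k + 14) * (n + 1)) + 2 := by
        gcongr; rw [hV]; nlinarith [Nat.zero_le n, Nat.zero_le k, Nat.zero_le Cs, Nat.zero_le (Cs * (k + 1))]
    _ ≤ (k' * (Cs * (k + 1) + k + 14) + 2) * (n + 1) := by nlinarith

/-- The input width is at most the input scale. [folklore] -/
theorem inputWidth_le_scaleP {k : ℕ} {φ : CNF ℕ} (hw : φ.IsWidthLE k) (hnd : φ.Nodup) :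
    inputWidth (encodeCNFWords φ) ≤ (k + 3) * scaleP φ.numVars k := by
  obtain ⟨hL, -, -⟩ := kSAT_size_bounds hw hnd ⟨0, 0, 0, 0, 0⟩
  obtain ⟨hP1, hnP, -⟩ := scaleP_facts φ.numVars k (numClauses_le_of_nodup hw hnd)
  have hk : 2 * scaleP φ.numVars k + k ≤ (k + 3) * scaleP φ.numVars k := by nlinarith [hP1]
  refine (inputWidth_le_size (V := (k + 3) * scaleP φ.numVars k) hL (by nlinarith) fun a ha => ?_).trans
    (Nat.size_le.2 Nat.lt_two_pow_self)
  rw [KSatTranscoder.encodeCNFWords_eq] at ha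
  simp only [List.mem_cons] at ha
  rcases ha with rfl | rfl | ha
  · omega
  · have := length_le_length_clauseWords φ
    rw [KSatTranscoder.encodeCNFWords_eq] at hL; simp at hL; unfold CNF.numClauses; omega
  · have := clauseWords_lt hw le_rfl a ha; omega

/-! ### The word size -/

namespace SerfRed

variable (Mt : TM2ComputableAux Γ' Γ')

/-- The constant of the word-size bound of the build phase and the stream. [folklore] -/
noncomputable def wconst (k c : ℕ) : ℕ :=
  (TM2Emu.enc Mt.tm).κ * (Complexity.TM2Comp.machinePushBound Mt.tm * c * (k + 5) ^ c + k + 8) + 3 * k + 332 +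
    (TM2Emu.enc Mt.tm).γ + TM2Emu.keyBound Mt.tm

/-- The word-size multiplier of the build phase (one bit of slack for the emulator's half). [folklore] -/
noncomputable def wmul₁ (k c : ℕ) : ℕ :=
  1 + (k + 3) * (c + 1) + Nat.size (2 * wconst Mt k c * 2 ^ ((k + 3) * (c + 1)))

/-- **The build phase and the stream fit in `wmul₁ (n + width)` bits**, with one bit to spare. [folklore] -/
theorem word_bounds₁ (k c n : ℕ) {L Y T' width : ℕ} (hL : L ≤ (k + 3) * scaleP n k) (hY : Y + 1 ≤ (k + 5) * scaleP n k)
    (hT : T' ≤ c * 2 ^ (1 * n) * (Y + 1) ^ c) (hw : 1 ≤ width) :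
    2 * L + 200 < 2 ^ (wmul₁ Mt k c * (n + width)) ∧
    (cellAddr (2 * L + 101 + Y) (TM2Emu.enc Mt.tm).κ (TM2Emu.enc Mt.tm).κ (TM2Emu.heightBound Mt.tm Y T') +
      (TM2Emu.enc Mt.tm).κ) * 2 < 2 ^ (wmul₁ Mt k c * (n + width)) ∧
    (TM2Emu.enc Mt.tm).γ + 1 < 2 ^ (wmul₁ Mt k c * (n + width)) ∧
    TM2Emu.keyBound Mt.tm < 2 ^ (wmul₁ Mt k c * (n + width)) := by
  set P := scaleP n k with hP
  set κ := (TM2Emu.enc Mt.tm).κ with hκ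
  set mp := Complexity.TM2Comp.machinePushBound Mt.tm with hmp
  set Z := 2 ^ (1 * n) * P ^ (c + 1) with hZ
  have hP1 : 1 ≤ P := Nat.one_le_pow _ _ (by omega)
  have h2d : 1 ≤ 2 ^ (1 * n) := Nat.one_le_two_pow
  have hZP : P ≤ Z := by
    calc P = 1 * P ^ 1 := by ring
      _ ≤ 2 ^ (1 * n) * P ^ (c + 1) := Nat.mul_le_mul h2d (Nat.pow_le_pow_right hP1 (by omega))
  have hZ1 : 1 ≤ Z := hP1.trans hZP
  have hZc : 2 ^ (1 * n) * P ^ c ≤ Z := Nat.mul_le_mul_left _ (Nat.pow_le_pow_right hP1 (by omega))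
  have hcore : ∀ X, X ≤ 2 * wconst Mt k c * Z → X < 2 ^ (wmul₁ Mt k c * (n + width)) := by
    intro X hX
    refine lt_two_pow_wordSize (A := 2 * wconst Mt k c * 2 ^ ((k + 3) * (c + 1))) (G := (k + 3) * (c + 1)) (d := 1)
      (hX.trans ?_) (Nat.lt_size_self _) hw
    have hPc : P ^ (c + 1) ≤ 2 ^ ((k + 3) * (c + 1)) * 2 ^ ((k + 3) * (c + 1) * n) := by
      calc P ^ (c + 1) ≤ (2 ^ ((k + 3) * (n + 1))) ^ (c + 1) := Nat.pow_le_pow_left (scaleP_le_two_pow n k) _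
        _ = 2 ^ ((k + 3) * (c + 1)) * 2 ^ ((k + 3) * (c + 1) * n) := by rw [← pow_mul, ← pow_add]; congr 1; ring
    calc 2 * wconst Mt k c * Z = 2 * wconst Mt k c * 2 ^ (1 * n) * P ^ (c + 1) := by rw [hZ]; ring
      _ ≤ 2 * wconst Mt k c * 2 ^ (1 * n) * (2 ^ ((k + 3) * (c + 1)) * 2 ^ ((k + 3) * (c + 1) * n)) := Nat.mul_le_mul_left _ hPc
      _ = 2 * wconst Mt k c * 2 ^ ((k + 3) * (c + 1)) * 2 ^ (1 * n) * 2 ^ ((k + 3) * (c + 1) * n) := by ring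
  have hwc : wconst Mt k c = κ * (mp * c * (k + 5) ^ c + k + 8) + 3 * k + 332 + (TM2Emu.enc Mt.tm).γ + TM2Emu.keyBound Mt.tm := rfl
  have hw1 : 1 ≤ wconst Mt k c := by rw [hwc]; omega
  refine ⟨hcore _ ?_, hcore _ ?_, hcore _ ?_, hcore _ ?_⟩
  · have : 2 * L + 200 ≤ (2 * k + 206) * Z := by
      calc 2 * L + 200 ≤ 2 * ((k + 3) * P) + 200 * P := by have := Nat.le_mul_of_pos_right 200 hP1; omega
        _ = (2 * k + 206) * P := by ring
        _ ≤ (2 * k + 206) * Z := Nat.mul_le_mul_left _ hZP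
    refine this.trans (Nat.mul_le_mul_right _ ?_)
    rw [hwc]; omega
  · have hT' : T' * mp ≤ mp * c * (k + 5) ^ c * Z := by
      calc T' * mp ≤ c * 2 ^ (1 * n) * (Y + 1) ^ c * mp := Nat.mul_le_mul_right _ hT
        _ ≤ c * 2 ^ (1 * n) * ((k + 5) * P) ^ c * mp := Nat.mul_le_mul_right _ (Nat.mul_le_mul_left _ (Nat.pow_le_pow_left hY _))
        _ = mp * c * (k + 5) ^ c * (2 ^ (1 * n) * P ^ c) := by rw [mul_pow]; ring
        _ ≤ mp * c * (k + 5) ^ c * Z := Nat.mul_le_mul_left _ hZc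
    have hYZ : Y ≤ (k + 5) * Z := by
      calc Y ≤ (k + 5) * P := by omega
        _ ≤ (k + 5) * Z := Nat.mul_le_mul_left _ hZP
    have hQ : 2 * L + 101 + Y ≤ (3 * k + 112) * Z := by
      calc 2 * L + 101 + Y ≤ 2 * ((k + 3) * P) + 101 * P + (k + 5) * P := by have := Nat.le_mul_of_pos_right 101 hP1; omega
        _ = (3 * k + 112) * P := by ring
        _ ≤ (3 * k + 112) * Z := Nat.mul_le_mul_left _ hZP
    have hκZ : κ ≤ κ * Z := Nat.le_mul_of_pos_right κ hZ1
    unfold cellAddr TM2Emu.heightBound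
    calc (2 * L + 101 + Y + κ + κ * (Y + T' * mp) + κ + κ) * 2
        ≤ ((3 * k + 112) * Z + κ * Z + κ * ((k + 5) * Z + mp * c * (k + 5) ^ c * Z) + κ * Z + κ * Z) * 2 := by gcongr
      _ = 2 * (κ * (mp * c * (k + 5) ^ c + k + 8) + 3 * k + 112) * Z := by ring
      _ ≤ 2 * wconst Mt k c * Z := Nat.mul_le_mul_right _ (Nat.mul_le_mul_left _ (by rw [hwc]; omega))
  · calc (TM2Emu.enc Mt.tm).γ + 1 ≤ ((TM2Emu.enc Mt.tm).γ + 1) * Z := Nat.le_mul_of_pos_right _ hZ1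
      _ ≤ 2 * wconst Mt k c * Z := Nat.mul_le_mul_right _ (by rw [hwc]; omega)
  · calc TM2Emu.keyBound Mt.tm ≤ TM2Emu.keyBound Mt.tm * Z := Nat.le_mul_of_pos_right _ hZ1
      _ ≤ 2 * wconst Mt k c * Z := Nat.mul_le_mul_right _ (by rw [hwc]; omega)

/-- **The word-size multiplier of the driver**: the build phase, the emulated word sizes of the
leaves, the constants of the sparse-`k`-SAT program, and `8` bits of headroom. [folklore] -/
noncomputable def wmul (k c k' Cs : ℕ) (M : Program) : ℕ :=
  wmul₁ Mt k c + (k' * (Cs * (k + 1) + k + 14) + 2) + (Nat.size (Program.maxConst M) + 2) + (Cs * (k + 1) + 16)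

end SerfRed

/-! ### The time bound -/
set_option maxHeartbeats 400000 in -- buildfix (bf3-g27): 160k/180k FAIL, 200k PASS at accept time; line-neutral budget line
/-- **The real-number bookkeeping of the driver's time bound.** A step count
`≤ A P + B T' + N (D P + 38 nmx + E)` — `P = (2(n+1))^{k+3}` the input scale, `T'` the sparsifier's
time `≤ c 2^{εn/2} (Y+1)^c` with `Y + 1 ≤ (k+5) P`, `N ≤ 2^{εn/2}` leaves, `nmx ≤ C₀ 2^{δn} + C₀`
emulated steps per leaf — is `≤ ⌊C 2^{(δ+ε)n} + C⌋₊` for the constant assembled below. [folklore] -/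
theorem steps_le_floor {steps A B D E P T' N nmx Y n k c : ℕ} {C₀ C₁ C₂ δ ε : ℝ} (hε : 0 < ε) (hδ : 0 ≤ δ)
    (hC₀ : 0 ≤ C₀) (hC₁0 : 0 ≤ C₁) (hC₂0 : 0 ≤ C₂) (hsteps : steps ≤ A * P + B * T' + N * (D * P + 38 * nmx + E))
    (hP : P = (2 * (n + 1)) ^ (k + 3)) (hT : (T' : ℝ) ≤ c * (2 : ℝ) ^ (ε / 2 * n) * ((Y : ℝ) + 1) ^ c)
    (hY : Y + 1 ≤ (k + 5) * P) (hN : (N : ℝ) ≤ (2 : ℝ) ^ (ε / 2 * n)) (hnmx : (nmx : ℝ) ≤ C₀ * (2 : ℝ) ^ (δ * n) + C₀)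
    (hC₁ : ((n : ℝ) + 1) ^ (k + 3) ≤ C₁ * (2 : ℝ) ^ (ε / 2 * n))
    (hC₂ : ((n : ℝ) + 1) ^ ((k + 3) * c) ≤ C₂ * (2 : ℝ) ^ (ε / 2 * n)) :
    steps ≤ ⌊(((A : ℝ) + D) * 2 ^ (k + 3) * C₁ + (B : ℝ) * c * (k + 5) ^ c * 2 ^ ((k + 3) * c) * C₂ + 76 * C₀ + E) *
        (2 : ℝ) ^ ((δ + ε) * n) +
      (((A : ℝ) + D) * 2 ^ (k + 3) * C₁ + (B : ℝ) * c * (k + 5) ^ c * 2 ^ ((k + 3) * c) * C₂ + 76 * C₀ + E)⌋₊ := by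
  set X : ℝ := (2 : ℝ) ^ ((δ + ε) * n) with hX
  set H : ℝ := (2 : ℝ) ^ (ε / 2 * n) with hH
  have hn0 : (0 : ℝ) ≤ n := Nat.cast_nonneg n
  have hH1 : 1 ≤ H := Real.one_le_rpow (by norm_num) (by positivity)
  have hH0 : 0 ≤ H := by linarith
  have hX1 : 1 ≤ X := Real.one_le_rpow (by norm_num) (by nlinarith)
  have hHH : H * H = (2 : ℝ) ^ (ε * n) := by rw [hH, ← Real.rpow_add (by norm_num)]; congr 1; ring
  have hεX : (2 : ℝ) ^ (ε * n) ≤ X := Real.rpow_le_rpow_of_exponent_le (by norm_num) (by nlinarith)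
  have hHX : H ≤ X := Real.rpow_le_rpow_of_exponent_le (by norm_num) (by nlinarith)
  have hHHX : H * H ≤ X := hHH ▸ hεX
  have hδH : (2 : ℝ) ^ (δ * n) * H ≤ X := by
    rw [hH, ← Real.rpow_add (by norm_num)]
    exact Real.rpow_le_rpow_of_exponent_le (by norm_num) (by nlinarith)
  -- the scale
  have hPr : (P : ℝ) ≤ 2 ^ (k + 3) * C₁ * H := by
    have e : (P : ℝ) = 2 ^ (k + 3) * ((n : ℝ) + 1) ^ (k + 3) := by rw [hP]; push_cast; rw [mul_pow]
    rw [e, mul_assoc]; exact mul_le_mul_of_nonneg_left hC₁ (by positivity)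
  have hPc : (P : ℝ) ^ c ≤ 2 ^ ((k + 3) * c) * C₂ * H := by
    have e : (P : ℝ) ^ c = 2 ^ ((k + 3) * c) * ((n : ℝ) + 1) ^ ((k + 3) * c) := by rw [hP]; push_cast; rw [← pow_mul, mul_pow]
    rw [e, mul_assoc]; exact mul_le_mul_of_nonneg_left hC₂ (by positivity)
  -- the sparsifier's time
  have hTr : (T' : ℝ) ≤ (c : ℝ) * (k + 5) ^ c * 2 ^ ((k + 3) * c) * C₂ * X := by
    have hY1 : ((Y : ℝ) + 1) ≤ (k + 5) * (P : ℝ) := by exact_mod_cast hY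
    calc (T' : ℝ) ≤ c * H * ((Y : ℝ) + 1) ^ c := hT
      _ ≤ c * H * ((k + 5) * (P : ℝ)) ^ c := by gcongr
      _ = c * (k + 5) ^ c * (P : ℝ) ^ c * H := by rw [mul_pow]; ring
      _ ≤ c * (k + 5) ^ c * (2 ^ ((k + 3) * c) * C₂ * H) * H := by gcongr
      _ = (c : ℝ) * (k + 5) ^ c * 2 ^ ((k + 3) * c) * C₂ * (H * H) := by ring
      _ ≤ (c : ℝ) * (k + 5) ^ c * 2 ^ ((k + 3) * c) * C₂ * X := by gcongr
  -- the terms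
  have h1 : (A : ℝ) * P ≤ (A : ℝ) * 2 ^ (k + 3) * C₁ * X := by
    calc (A : ℝ) * P ≤ A * (2 ^ (k + 3) * C₁ * H) := by gcongr
      _ ≤ A * (2 ^ (k + 3) * C₁ * X) := by gcongr
      _ = _ := by ring
  have h2 : (B : ℝ) * T' ≤ (B : ℝ) * c * (k + 5) ^ c * 2 ^ ((k + 3) * c) * C₂ * X := by
    calc (B : ℝ) * T' ≤ B * ((c : ℝ) * (k + 5) ^ c * 2 ^ ((k + 3) * c) * C₂ * X) := by gcongr
      _ = _ := by ring
  have hN0 : (0 : ℝ) ≤ N := Nat.cast_nonneg N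
  have h3 : (N : ℝ) * (D * P) ≤ (D : ℝ) * 2 ^ (k + 3) * C₁ * X := by
    calc (N : ℝ) * (D * P) ≤ H * (D * (2 ^ (k + 3) * C₁ * H)) := by gcongr
      _ = (D : ℝ) * 2 ^ (k + 3) * C₁ * (H * H) := by ring
      _ ≤ (D : ℝ) * 2 ^ (k + 3) * C₁ * X := by gcongr
  have h4 : (N : ℝ) * (38 * nmx) ≤ 76 * C₀ * X := by
    calc (N : ℝ) * (38 * nmx) ≤ H * (38 * (C₀ * (2 : ℝ) ^ (δ * n) + C₀)) := by gcongr
      _ = 38 * C₀ * ((2 : ℝ) ^ (δ * n) * H) + 38 * C₀ * H := by ring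
      _ ≤ 38 * C₀ * X + 38 * C₀ * X := by gcongr
      _ = 76 * C₀ * X := by ring
  have h5 : (N : ℝ) * E ≤ (E : ℝ) * X := by
    calc (N : ℝ) * E ≤ H * E := by gcongr
      _ ≤ X * E := by gcongr
      _ = (E : ℝ) * X := by ring
  have hsum : (steps : ℝ) ≤ (((A : ℝ) + D) * 2 ^ (k + 3) * C₁ + (B : ℝ) * c * (k + 5) ^ c * 2 ^ ((k + 3) * c) * C₂ + 76 * C₀ + E) * X := by
    have := (Nat.cast_le (α := ℝ)).2 hsteps
    push_cast at this
    have e : (N : ℝ) * (D * P + 38 * nmx + E) = N * (D * P) + N * (38 * nmx) + N * E := by ring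
    rw [e] at this
    nlinarith
  have hK0 : 0 ≤ ((A : ℝ) + D) * 2 ^ (k + 3) * C₁ + (B : ℝ) * c * (k + 5) ^ c * 2 ^ ((k + 3) * c) * C₂ + 76 * C₀ + E := by positivity
  refine Nat.le_floor ?_
  linarith

/-- **The build phase in the scale**: `preTime ≤ (41 k + 215 + bootCost) P + (stepCost + 2) T'`. [folklore] -/
theorem SerfRed.preTime_le (Mt : TM2ComputableAux Γ' Γ') {k : ℕ} {φ : CNF ℕ} (hw : φ.IsWidthLE k) (hnd : φ.Nodup) (T' : ℕ) :
    SerfRed.preTime Mt φ T' ≤ (41 * k + 215 + TM2Emu.bootCost Mt.tm) * scaleP φ.numVars k +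
      ((TM2Emu.enc Mt.tm).stepCost Mt.tm.m + 2) * T' := by
  obtain ⟨hL, hY, ht⟩ := kSAT_size_bounds hw hnd (SerfRed.icodes Mt)
  have hP1 : 1 ≤ scaleP φ.numVars k := Nat.one_le_pow _ _ (by omega)
  have e : (41 * k + 215 + TM2Emu.bootCost Mt.tm) * scaleP φ.numVars k =
      7 * ((k + 3) * scaleP φ.numVars k) + (35 + 25 * k) * scaleP φ.numVars k + 9 * ((k + 5) * scaleP φ.numVars k) +
        114 * scaleP φ.numVars k + TM2Emu.bootCost Mt.tm * scaleP φ.numVars k := by ring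
  have hb := Nat.le_mul_of_pos_right (TM2Emu.bootCost Mt.tm) hP1
  unfold SerfRed.preTime
  rw [e, Nat.mul_comm T']
  omega

open scoped Classical in
/-- **One instance of the driver, in the polynomial scale.** For a `k`-CNF `φ` without repeated
clauses on `n` variables (`P = (2(n+1))^{k+3}`), leaves `Ψ` of the sparsifier with its contract, a
sparse-`k`-SAT program with its contract on the presented formulas, a machine run within
`T' ≤ c 2^n (L'+1)^c` steps, and a word-size multiplier `K` dominating the four components of
`SerfRed.wmul`, the driver run at word size `K (n + width)` outputs the answer within
`A P + B T' + N (D P + 38 nmax + 124)` steps for the displayed constants. [folklore] -/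
theorem SerfRed.driver_instance (Mt : TM2ComputableAux Γ' Γ') (k k' c Cs K nmax T' bc sc mp : ℕ) {M : Program}
    (hdet : M.IsDeterministic) (hof : M.IsOracleFree) (φ : CNF ℕ) (hwid : φ.IsWidthLE k) (hnd : φ.Nodup)
    (Ψ : List (KCNF k)) (hleaf : ∀ ψ ∈ Ψ, ψ.numVars = φ.numVars ∧ ψ.clauses.length ≤ Cs * φ.numVars ∧ ψ.clauses.Nodup)
    (hΨeq : φ.Satisfiable ↔ ∃ ψ ∈ Ψ, ψ.Satisfiable) (hNnat : Ψ.length ≤ 2 ^ φ.numVars)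
    (hrun : Mt.OutputsWithin (KCNF.encode (toKCNF k φ hwid)) (KCNF.encodeList Ψ) T')
    (hTn : T' ≤ c * 2 ^ (1 * φ.numVars) * ((toKCNF k φ hwid).encode.length + 1) ^ c)
    (hMx : ∀ cs : CNF ℕ, cs.IsWidthLE k → cs.Nodup → CNF.numClauses cs ≤ max (Cs + 1) 2 * CNF.numVars cs →
      CNF.numVars cs ≤ φ.numVars → ∃ (cfg : Cfg) (t : ℕ), t ≤ nmax ∧
        HaltsWithin M (k' * (CNF.numVars cs + inputWidth (encodeCNFWords cs))) noOracle zeroCoins (encodeCNFWords cs) t cfg ∧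
        readOut cfg.mem = [if cs.Satisfiable then 1 else 0])
    (hK1 : SerfRed.wmul₁ Mt k c ≤ K) (hK2 : k' * (Cs * (k + 1) + k + 14) + 2 ≤ K) (hK3 : Nat.size (Program.maxConst M) + 2 ≤ K)
    (hK4 : Cs * (k + 1) + 16 ≤ K) (hbc : TM2Emu.bootCost Mt.tm = bc) (hsc : (TM2Emu.enc Mt.tm).stepCost Mt.tm.m = sc)
    (hmp : Complexity.TM2Comp.machinePushBound Mt.tm = mp) :
    OutputsWithin (SerfRed.driver Mt k k' M) (K * (φ.numVars + inputWidth (encodeCNFWords φ))) noOracle zeroCoins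
      (encodeCNFWords φ) [if φ.Satisfiable then 1 else 0]
      ((41 * k + 215 + bc + 4 * K * (k + 4) + 19 * (k + 5) + 4) * scaleP φ.numVars k + (sc + 2 + 19 * mp) * T' +
        Ψ.length * ((7 * Cs * (k + 1) + 4 * K * (k + 4)) * scaleP φ.numVars k + 38 * nmax + 124)) := by
  -- sizes
  obtain ⟨hLb, hYb, -⟩ := kSAT_size_bounds hwid hnd (SerfRed.icodes Mt)
  have hcds : ((SerfRed.icodes Mt).cnfCodes φ).length = (toKCNF k φ hwid).encode.length := by
    rw [SerfRed.cnfCodes_eq_map_inp Mt φ hwid, List.length_map, SerfRed.inp, List.length_map]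
  rw [hcds] at hYb
  have hP1 : 1 ≤ scaleP φ.numVars k := Nat.one_le_pow _ _ (by omega)
  have hnP : φ.numVars + 1 ≤ scaleP φ.numVars k := (scaleP_facts φ.numVars k (numClauses_le_of_nodup hwid hnd)).2.1
  have hwidth1 : 1 ≤ inputWidth (encodeCNFWords φ) := inputWidth_pos _
  have hwidthP : inputWidth (encodeCNFWords φ) ≤ (k + 3) * scaleP φ.numVars k := inputWidth_le_scaleP hwid hnd
  have hK8 : 8 ≤ K := by omega
  -- the word size
  have h2K : ∀ {X : ℕ}, X < 2 ^ (SerfRed.wmul₁ Mt k c * (φ.numVars + inputWidth (encodeCNFWords φ))) →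
      X < 2 ^ (K * (φ.numVars + inputWidth (encodeCNFWords φ))) := fun h =>
    lt_of_lt_of_le h (Nat.pow_le_pow_right (by norm_num) (Nat.mul_le_mul_right _ hK1))
  obtain ⟨hw1, hw2, hw3, hw4⟩ := SerfRed.word_bounds₁ Mt k c φ.numVars hLb hYb hTn hwidth1
  have hwK : 2 * (φ.numVars + inputWidth (encodeCNFWords φ)) ≤ K * (φ.numVars + inputWidth (encodeCNFWords φ)) :=
    Nat.mul_le_mul_right _ (by omega)
  have hKw : K ≤ K * (φ.numVars + inputWidth (encodeCNFWords φ)) := Nat.le_mul_of_pos_right _ (by omega)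
  have hww : K * (φ.numVars + inputWidth (encodeCNFWords φ)) < 2 ^ (K * (φ.numVars + inputWidth (encodeCNFWords φ))) :=
    Nat.lt_two_pow_self
  -- abbreviate the word size
  revert h2K hw1 hw2 hw3 hw4 hwK hKw hww
  generalize hwdef : K * (φ.numVars + inputWidth (encodeCNFWords φ)) = w
  intro h2K hw1 hw2 hw3 hw4 hwK hKw hww
  have hw8 : 8 ≤ w := by omega
  have hn2 : φ.numVars < 2 ^ (w - 2) := lt_of_lt_of_le Nat.lt_two_pow_self (Nat.pow_le_pow_right (by norm_num) (by omega))
  have h4w : 2 ^ (w - 2) + 2 ^ (w - 2) = 2 ^ (w - 1) := by rw [← two_mul, ← pow_succ']; congr 1; omega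
  have h2w : 2 ^ (w - 1) + 2 ^ (w - 1) = 2 ^ w := by rw [← two_mul, ← pow_succ']; congr 1; omega
  -- the leaves
  have hΨn : ∀ ψ ∈ Ψ, CNF.numVars ψ.clauses ≤ φ.numVars := fun ψ hψ =>
    (numVars_le_of_lt fun c hc l hl => ψ.fst_lt_numVars c hc l hl).trans (le_of_eq (hleaf ψ hψ).1)
  have hΨc : ∀ ψ ∈ Ψ, ψ.clauses.length ≤ Cs * φ.numVars := fun ψ hψ => (hleaf ψ hψ).2.1
  have hΨnd : ∀ ψ ∈ Ψ, ψ.clauses.Nodup := fun ψ hψ => (hleaf ψ hψ).2.2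
  have hΨY : ∀ ψ ∈ Ψ, (KSatTranscoder.clauseWords ψ.clauses).length ≤ Cs * φ.numVars * (k + 1) := fun ψ hψ =>
    (length_clauseWords_le ψ.length_le).trans (Nat.mul_le_mul_right _ (hΨc ψ hψ))
  -- the remaining word-size facts
  have hQof : SerfRed.Qof Mt φ = 2 * (encodeCNFWords φ).length + 101 + ((SerfRed.icodes Mt).cnfCodes φ).length := rfl
  have hcell : cellAddr (SerfRed.Qof Mt φ) (TM2Emu.enc Mt.tm).κ (TM2Emu.enc Mt.tm).κ
      (TM2Emu.heightBound Mt.tm ((SerfRed.icodes Mt).cnfCodes φ).length T') + (TM2Emu.enc Mt.tm).κ < 2 ^ (w - 1) := by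
    rw [hQof, hcds]
    have h := h2K hw2
    rw [← h2w] at h
    omega
  have hnwlt : φ.numVars + w < 2 ^ w := by have := two_mul_lt_two_pow (show 3 ≤ w by omega); omega
  have hsz : Nat.size φ.numVars + 2 ≤ w := by have := Nat.size_le.2 (Nat.lt_two_pow_self (n := φ.numVars)); omega
  have hYw : Cs * φ.numVars * (k + 1) + 9 < 2 ^ (w - 2) := by
    have h1 : (Cs * (k + 1) + 16) * (φ.numVars + inputWidth (encodeCNFWords φ)) ≤ w := (Nat.mul_le_mul_right _ hK4).trans (by omega)
    have e : (Cs * (k + 1) + 16) * (φ.numVars + inputWidth (encodeCNFWords φ)) =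
        Cs * (k + 1) * (φ.numVars + inputWidth (encodeCNFWords φ)) + 16 * (φ.numVars + inputWidth (encodeCNFWords φ)) := by ring
    have h21 : Cs * φ.numVars * (k + 1) = Cs * (k + 1) * φ.numVars := by ring
    have h22 : Cs * (k + 1) * φ.numVars ≤ Cs * (k + 1) * (φ.numVars + inputWidth (encodeCNFWords φ)) := Nat.mul_le_mul_left _ (by omega)
    have h3 : w - 2 < 2 ^ (w - 2) := Nat.lt_two_pow_self
    omega
  have hN : Ψ.length + 1 < 2 ^ w := by
    have : 2 ^ φ.numVars ≤ 2 ^ (w - 2) := Nat.pow_le_pow_right (by norm_num) (by omega)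
    omega
  have hws : ∀ ψ ∈ Ψ, k' * (CNF.numVars (pres k φ.numVars ψ.clauses) +
      inputWidth (encodeCNFWords (pres k φ.numVars ψ.clauses))) + 2 ≤ w := fun ψ hψ =>
    (ws_le (Cs := Cs) ψ.length_le (hΨn ψ hψ) (hΨc ψ hψ)).trans
      ((Nat.mul_le_mul_left _ (by omega : φ.numVars + 1 ≤ φ.numVars + inputWidth (encodeCNFWords φ))).trans
        ((Nat.mul_le_mul_right _ hK2).trans (by omega)))
  have hMc : Program.maxConst M < 2 ^ (w - 2) :=
    lt_of_lt_of_le (Nat.lt_size_self _) (Nat.pow_le_pow_right (by norm_num) (by omega))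
  -- the run of the driver
  have hdrv := SerfRed.driver_outputsWithin Mt k k' hdet hof (w := w) (Cs := Cs) (Cd := max (Cs + 1) 2) (nmax := nmax)
    (Y := Cs * φ.numVars * (k + 1)) (T' := T') φ hwid Ψ hΨn hΨc hΨnd hΨeq hΨY le_rfl hrun hMx hw8 (by omega) (h2K hw1) hcell
    (h2K hw3) (h2K hw4) (by omega) hnwlt hsz hYw hN hws hMc zeroCoins
  refine hdrv.mono ?_
  -- the step count in the scale
  have hpre := SerfRed.preTime_le Mt hwid hnd T'
  rw [hbc, hsc] at hpre
  have hJ : (KCNF.encodeList Ψ).length ≤ (toKCNF k φ hwid).encode.length + mp * T' := by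
    have := TM2Comp.length_le_of_outputsWithin Mt hrun; rw [hmp] at this; exact this
  have hwP : w ≤ K * (k + 4) * scaleP φ.numVars k := by
    calc w ≤ K * (scaleP φ.numVars k + (k + 3) * scaleP φ.numVars k) := by
          have := Nat.mul_le_mul_left K (Nat.add_le_add (le_of_lt hnP) hwidthP); omega
      _ = K * (k + 4) * scaleP φ.numVars k := by ring
  have hYP : Cs * φ.numVars * (k + 1) ≤ Cs * (k + 1) * scaleP φ.numVars k := by
    calc Cs * φ.numVars * (k + 1) = Cs * (k + 1) * φ.numVars := by ring
      _ ≤ Cs * (k + 1) * scaleP φ.numVars k := Nat.mul_le_mul_left _ (by omega)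
  have hleafc : 7 * (Cs * φ.numVars * (k + 1)) + 4 * w + 111 + cstep * nmax + 13 ≤
      (7 * Cs * (k + 1) + 4 * K * (k + 4)) * scaleP φ.numVars k + 38 * nmax + 124 := by
    rw [cstep]
    have : (7 * Cs * (k + 1) + 4 * K * (k + 4)) * scaleP φ.numVars k =
        7 * (Cs * (k + 1) * scaleP φ.numVars k) + 4 * (K * (k + 4) * scaleP φ.numVars k) := by ring
    omega
  have hNl := Nat.mul_le_mul_left Ψ.length hleafc
  have e1 : (41 * k + 215 + bc + 4 * K * (k + 4) + 19 * (k + 5) + 4) * scaleP φ.numVars k =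
      (41 * k + 215 + bc) * scaleP φ.numVars k + 4 * (K * (k + 4) * scaleP φ.numVars k) + 19 * ((k + 5) * scaleP φ.numVars k) +
        4 * scaleP φ.numVars k := by ring
  have e2 : (sc + 2 + 19 * mp) * T' = (sc + 2) * T' + 19 * (mp * T') := by ring
  omega

open scoped Classical in
/-- **Sparsification as a SERF reduction on the word RAM, at SETH granularity — the named fact
`kSATInRAMTime_of_sparseKSATInRAMTime_serf` proved** (Impagliazzo–Paturi–Zane, JCSS 63 (2001),
Thm. 1, Cor. 1 and Cor. 2, read on the word RAM). For `k` and `ε > 0` (without loss of generality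
`ε ≤ 1`, by monotonicity) take the density `C = max (C_s + 1) 2`, `C_s` the constant of the
sparsification lemma at `ε/2` (`sparsification_nodup`). Given `δ ≥ 0` and a word-RAM program deciding
the `k`-CNFs with at most `C · n` pairwise distinct clauses in time `O(2^{δ n})`
(`SparseKSATInRAMTime k C δ`), the program `SerfRed.driver` — relocate and transcode the input,
simulate the multi-stack sparsifier with constant overhead, and for each of the `≤ 2^{ε n/2}` leaves
parse it, pad it with `x_{n-1} ∨ ¬x_{n-1}` when its last variable is absent (present the empty formula
when it has an empty clause), run the given program in the emulator at its own word size, and or the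
answers — decides every `k`-CNF (`SerfRed.driver_instance`); its time
`poly(n) · 2^{ε n/2} + 2^{ε n/2} · O(2^{δ n})` is `O(2^{(δ+ε) n})` (`steps_le_floor`), with
`Θ(n)`-bit words. [cite: ImpagliazzoPaturiZaneJCSS2001, Theorem 1, Corollary 1 and Corollary 2] -/
theorem kSATInRAMTime_of_sparseKSATInRAMTime_serf_holds : kSATInRAMTime_of_sparseKSATInRAMTime_serf := by
  intro k ε₀ hε₀
  -- without loss of generality `ε ≤ 1` (the conclusion is monotone in the exponent)
  suffices h : ∀ ε : ℝ, 0 < ε → ε ≤ 1 → ∃ C : ℕ, ∀ δ : ℝ, 0 ≤ δ → SparseKSATInRAMTime k C δ → KSATInRAMTime k (δ + ε) by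
    obtain ⟨C, hC⟩ := h (min ε₀ 1) (lt_min hε₀ one_pos) (min_le_right _ _)
    exact ⟨C, fun δ hδ hs => (hC δ hδ hs).mono (by have := min_le_left ε₀ 1; linarith)⟩
  intro ε hε hε1
  have hε2 : 0 < ε / 2 := half_pos hε
  obtain ⟨Cs, F, T, hF, ⟨c, hc⟩, Mt, hMt⟩ := sparsification_nodup k (ε / 2) hε2
  refine ⟨max (Cs + 1) 2, fun δ hδ hsparse => ?_⟩
  obtain ⟨M, k', C₀, hdet, hof, hM⟩ := hsparse
  -- constants
  have hC₀'0 : 0 ≤ max C₀ 0 := le_max_right _ _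
  obtain ⟨C₁, hC₁0, hC₁⟩ := exists_pow_le_two_rpow (k + 3) hε2
  obtain ⟨C₂, hC₂0, hC₂⟩ := exists_pow_le_two_rpow ((k + 3) * c) hε2
  obtain ⟨bc, hbc⟩ : ∃ bc : ℕ, TM2Emu.bootCost Mt.tm = bc := ⟨_, rfl⟩
  obtain ⟨sc, hsc⟩ : ∃ sc : ℕ, (TM2Emu.enc Mt.tm).stepCost Mt.tm.m = sc := ⟨_, rfl⟩
  obtain ⟨mp, hmp⟩ : ∃ mp : ℕ, Complexity.TM2Comp.machinePushBound Mt.tm = mp := ⟨_, rfl⟩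
  obtain ⟨K, hK⟩ : ∃ K : ℕ, SerfRed.wmul Mt k c k' Cs M = K := ⟨_, rfl⟩
  have hK1 : SerfRed.wmul₁ Mt k c ≤ K := by rw [← hK]; unfold SerfRed.wmul; omega
  have hK2 : k' * (Cs * (k + 1) + k + 14) + 2 ≤ K := by rw [← hK]; unfold SerfRed.wmul; omega
  have hK3 : Nat.size (Program.maxConst M) + 2 ≤ K := by rw [← hK]; unfold SerfRed.wmul; omega
  have hK4 : Cs * (k + 1) + 16 ≤ K := by rw [← hK]; unfold SerfRed.wmul; omega
  -- the time constants: steps ≤ A P + B T' + N (D P + 38 nmax + E)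
  obtain ⟨A, hA⟩ : ∃ A : ℕ, 41 * k + 215 + bc + 4 * K * (k + 4) + 19 * (k + 5) + 4 = A := ⟨_, rfl⟩
  obtain ⟨B, hB⟩ : ∃ B : ℕ, sc + 2 + 19 * mp = B := ⟨_, rfl⟩
  obtain ⟨D, hD⟩ : ∃ D : ℕ, 7 * Cs * (k + 1) + 4 * K * (k + 4) = D := ⟨_, rfl⟩
  refine ⟨SerfRed.driver Mt k k' M, K,
    ((A : ℝ) + D) * 2 ^ (k + 3) * C₁ + (B : ℝ) * c * (k + 5) ^ c * 2 ^ ((k + 3) * c) * C₂ + 76 * max C₀ 0 + (124 : ℕ),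
    SerfRed.driver_isDeterministic Mt k k' M, SerfRed.driver_isOracleFree Mt k k' M, fun φ => ?_⟩
  obtain ⟨φ, hwid, hnd⟩ := φ
  obtain ⟨hNr, hleaf, heq⟩ := hF (toKCNF k φ hwid)
  change ((F (toKCNF k φ hwid)).length : ℝ) ≤ (2 : ℝ) ^ (ε / 2 * (φ.numVars : ℕ)) at hNr
  -- the leaves decide `φ`
  have hΨeq : φ.Satisfiable ↔ ∃ ψ ∈ F (toKCNF k φ hwid), ψ.Satisfiable := by
    rw [← toKCNF_satisfiable_iff φ hwid, KCNF.satisfiable_iff_exists_eval]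
    constructor
    · rintro ⟨v, hv⟩
      obtain ⟨ψ, hψ, hψv⟩ := (heq v).1 hv
      exact ⟨ψ, hψ, (KCNF.satisfiable_iff_exists_eval ψ).2 ⟨v, hψv⟩⟩
    · rintro ⟨ψ, hψ, hs⟩
      obtain ⟨v, hv⟩ := (KCNF.satisfiable_iff_exists_eval ψ).1 hs
      exact ⟨v, (heq v).2 ⟨ψ, hψ, hv⟩⟩
  -- the number of leaves as a natural number
  have hNnat : (F (toKCNF k φ hwid)).length ≤ 2 ^ φ.numVars := by
    have h1 : (((F (toKCNF k φ hwid)).length : ℕ) : ℝ) ≤ ((2 ^ φ.numVars : ℕ) : ℝ) := by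
      calc (((F (toKCNF k φ hwid)).length : ℕ) : ℝ) ≤ (2 : ℝ) ^ (ε / 2 * (φ.numVars : ℕ)) := hNr
        _ ≤ (2 : ℝ) ^ ((1 : ℝ) * (φ.numVars : ℕ)) :=
            Real.rpow_le_rpow_of_exponent_le (by norm_num) (mul_le_mul_of_nonneg_right (by linarith) (Nat.cast_nonneg _))
        _ = ((2 ^ φ.numVars : ℕ) : ℝ) := by rw [one_mul, Nat.cast_pow, Nat.cast_ofNat, Real.rpow_natCast]
    exact_mod_cast h1
  -- the machine's time as a natural number
  have hcr := hc φ.numVars (toKCNF k φ hwid).encode.length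
  have hTn : T φ.numVars (toKCNF k φ hwid).encode.length ≤
      c * 2 ^ (1 * φ.numVars) * ((toKCNF k φ hwid).encode.length + 1) ^ c := by
    have h2 : (2 : ℝ) ^ (ε / 2 * (φ.numVars : ℕ)) ≤ (2 : ℝ) ^ ((1 : ℝ) * (φ.numVars : ℕ)) :=
      Real.rpow_le_rpow_of_exponent_le (by norm_num) (mul_le_mul_of_nonneg_right (by linarith) (Nat.cast_nonneg _))
    have h3 : (2 : ℝ) ^ ((1 : ℝ) * (φ.numVars : ℕ)) = ((2 ^ (1 * φ.numVars) : ℕ) : ℝ) := by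
      rw [one_mul, Nat.one_mul, Nat.cast_pow, Nat.cast_ofNat, Real.rpow_natCast]
    have : ((T φ.numVars (toKCNF k φ hwid).encode.length : ℕ) : ℝ) ≤
        ((c * 2 ^ (1 * φ.numVars) * ((toKCNF k φ hwid).encode.length + 1) ^ c : ℕ) : ℝ) := by
      calc _ ≤ c * 2 ^ (ε / 2 * (φ.numVars : ℕ)) * (((toKCNF k φ hwid).encode.length : ℝ) + 1) ^ c := hcr
        _ ≤ c * 2 ^ ((1 : ℝ) * (φ.numVars : ℕ)) * (((toKCNF k φ hwid).encode.length : ℝ) + 1) ^ c := by gcongr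
        _ = _ := by rw [h3]; push_cast; ring
    exact_mod_cast this
  -- the sparse decider on the presented formulas
  have hMx : ∀ cs : CNF ℕ, cs.IsWidthLE k → cs.Nodup → CNF.numClauses cs ≤ max (Cs + 1) 2 * CNF.numVars cs →
      CNF.numVars cs ≤ φ.numVars → ∃ (cfg : Cfg) (t : ℕ), t ≤ ⌊max C₀ 0 * (2 : ℝ) ^ (δ * φ.numVars) + max C₀ 0⌋₊ ∧
        HaltsWithin M (k' * (CNF.numVars cs + inputWidth (encodeCNFWords cs))) noOracle zeroCoins (encodeCNFWords cs) t cfg ∧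
        readOut cfg.mem = [if cs.Satisfiable then 1 else 0] := by
    intro cs hw' hnd' hdens hnv
    obtain ⟨out, hout, hrunM⟩ := hM ⟨cs, hw', hnd'⟩ hdens
    change out ∈ CNFSAT.Good cs at hout
    rw [CNFSAT_good_iff] at hout
    obtain ⟨cfg, hhalt, hread⟩ := (outputsWithin_iff_exists_haltsWithin _ _ _ _ _ _ _).1 hrunM
    refine ⟨cfg, _, Nat.floor_le_floor ?_, hhalt, by rw [hread, hout]⟩
    change C₀ * (2 : ℝ) ^ (δ * (CNF.numVars cs : ℕ)) + C₀ ≤ max C₀ 0 * (2 : ℝ) ^ (δ * φ.numVars) + max C₀ 0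
    have h1 : C₀ ≤ max C₀ 0 := le_max_left _ _
    have h2 : (2 : ℝ) ^ (δ * (CNF.numVars cs : ℕ)) ≤ (2 : ℝ) ^ (δ * φ.numVars) :=
      Real.rpow_le_rpow_of_exponent_le (by norm_num) (mul_le_mul_of_nonneg_left (by exact_mod_cast hnv) hδ)
    have h3 : (0 : ℝ) ≤ (2 : ℝ) ^ (δ * (CNF.numVars cs : ℕ)) := by positivity
    calc C₀ * (2 : ℝ) ^ (δ * (CNF.numVars cs : ℕ)) + C₀ ≤ max C₀ 0 * (2 : ℝ) ^ (δ * (CNF.numVars cs : ℕ)) + max C₀ 0 := by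
          have := mul_le_mul_of_nonneg_right h1 h3; linarith
      _ ≤ max C₀ 0 * (2 : ℝ) ^ (δ * φ.numVars) + max C₀ 0 := by have := mul_le_mul_of_nonneg_left h2 hC₀'0; linarith
  -- the run in the scale
  have hdrv := SerfRed.driver_instance Mt k k' c Cs K _ _ bc sc mp hdet hof φ hwid hnd (F (toKCNF k φ hwid)) hleaf hΨeq hNnat
    (hMt (toKCNF k φ hwid)) hTn hMx hK1 hK2 hK3 hK4 hbc hsc hmp
  refine ⟨[if φ.Satisfiable then 1 else 0], (CNFSAT_good_iff φ _).2 rfl, hdrv.mono ?_⟩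
  -- the time bound
  obtain ⟨-, hYb, -⟩ := kSAT_size_bounds hwid hnd (SerfRed.icodes Mt)
  rw [SerfRed.cnfCodes_eq_map_inp Mt φ hwid, List.length_map, SerfRed.inp, List.length_map] at hYb
  have := steps_le_floor (steps := (41 * k + 215 + bc + 4 * K * (k + 4) + 19 * (k + 5) + 4) * scaleP φ.numVars k +
      (sc + 2 + 19 * mp) * T φ.numVars (toKCNF k φ hwid).encode.length +
      (F (toKCNF k φ hwid)).length * ((7 * Cs * (k + 1) + 4 * K * (k + 4)) * scaleP φ.numVars k +
        38 * ⌊max C₀ 0 * (2 : ℝ) ^ (δ * φ.numVars) + max C₀ 0⌋₊ + 124))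
    (A := A) (B := B) (D := D) (E := 124) (P := scaleP φ.numVars k) hε hδ hC₀'0 hC₁0 hC₂0 (by rw [← hA, ← hB, ← hD]) rfl hcr hYb hNr
    (Nat.floor_le (by positivity)) (hC₁ φ.numVars) (hC₂ φ.numVars)
  exact this

end Literature.Computability.FineGrained
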